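import Summits.HodgeConjecture.HodgeConjecture.Theorems.R90S2ArchHaarProduct          -- ★ p864547 CARD 6: Haar measures along ★ `archPiEquivCM` (`Measure.pi`, `exists_pi_eq_map_archPiEquivCM`)
import Summits.HodgeConjecture.HodgeConjecture.Theorems.R90S10ArchSignKitDefs         -- ★ S10 kit carriers `GInf L`, `phi3 L` (CARD 8's frame spelling)
import Literature.NumberTheory.Automorphic.ArchLocalRelabelTransport                  -- ★ `isMulRightInvariant_map_continuousMulEquiv`
import Literature.NumberTheory.Automorphic.ArchLocalRegularOrbitClosed                -- ★ `locallyCompactSpace_archLocal`, `secondCountableTopology_archLocal`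
import HarnessLib

/-!
# R90-TF ∕ S2 «Ch. 12 archimedean block» — CARD 6♯ `R90S2ArchHaarPiRightInvariant`: the factors of a RIGHT-INVARIANT product measure are right-invariant

Cell `pub/hodgecm-mathlib`, HCML Track R90-TF, section S2 (base `R90-C11`); crux h413 = `stmt-HodgeConjecture-24833`, route of record `HCCMUnconditional`.
Hand: prover seat hodgecm-mathlib-K2E3-p25 (g5); dealer K2E1b-plan (g9) RULING R-S2-D4 + DEALS 2026-09-05T03:41:55Z (2)(b′) (audit1 (g2) J-D4-RI + R1∕R2).
THEOREMS ONLY (proof lane); NO def, NO socket, NO instance, NO notation, NO `sorry`, default heartbeats.  E-grade (Mathlib product measures).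

## WHY

D ED. 4 relocates the letter clause (E2) to print's LOCAL shape `IsArchLocStablyNull L u (νw u) …` (CARD 11), whose frame needs the local Haar measures `νw w`
to be RIGHT-invariant; CARD 8's frame only knows `ν` right-invariant on `G_∞` and `ν.map archPiEquivCM = ⊗_w νw w`.  This file supplies the missing instance:
a factor of a right-invariant finite product measure with non-degenerate factors is right-invariant (§1), hence every `νw w` is (§2) — the supplier of CARD 12's bridge
`ArchBlockPacketEndoscopyLetterLoc → ArchBlockPacketEndoscopyLetter`.

## WHAT IS PROVED

* §1 `isMulRightInvariant_of_pi` (generic; NO `[DecidableEq ι]` in the statement — audit R2): if `⊗ᵢ νᵢ` is right-invariant on the product group and every factor has a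
  measurable set `Kᵢ` with `0 < νᵢ Kᵢ < ∞`, then each `νᵢ` is right-invariant.  PROOF: evaluate `(⊗ ν)((· * mulSingle i g)⁻¹' box) = (⊗ ν)(box)` on the box
  `Set.univ.pi (update K i A)` (`Measure.pi_pi` twice); right translation by `Pi.mulSingle i g` moves coordinate `i` only; cancel `∏_{j ≠ i} νⱼ Kⱼ ∈ (0, ∞)`
  (`ENNReal.mul_left_inj`); `Measure.ext`.
* §2 **`isMulRightInvariant_of_map_archPiEquivCM_eq_pi`** (binders spelled as CARD 8 :140–146 ∕ ℓT2-E v2 :89–93 — audit R1, nothing beyond CARD 8's frame):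
  `(ν : Measure (GInf L)) [ν.IsHaarMeasure] [ν.IsMulRightInvariant] … (νw) [∀ w, (νw w).IsHaarMeasure] (hν : ν.map ⇑(archPiEquivCM L (phi3 L) (N := 3)) = Measure.pi νw) (w) :
  (νw w).IsMulRightInvariant` — `⊗ νw = ν.map e` is right-invariant by ★ `isMulRightInvariant_map_continuousMulEquiv`; the sets `K_w` are compact neighbourhoods of `1`
  (Haar measures are positive on open sets and finite on compacts; ★ `locallyCompactSpace_archLocal`, ★ `secondCountableTopology_archLocal` for σ-finiteness and the
  product Borel structure).

HONEST LABEL: measure-theory plumbing; pays NO printed input; HC_CM is proved only modulo the 7 printed citations (2 remaining named inputs: hLiu418 =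
`stmt-HodgeConjecture-24832`, h413 = `stmt-HodgeConjecture-24833`) until rung 0 closes.  Count-neutral helper (`--supports stmt-HodgeConjecture-24833 --as helper`).

References: [Folland1995] §2.2 (2.20), (2.52) (Haar measures, products, uniqueness); [BourbakiINT7] Ch. VII §1 no. 2; [Rogawski1990] §14.2 p. 232 (`G_∞ = ∏_v G_v`,
product measures).
-/

set_option autoImplicit false
set_option linter.dupNamespace false

noncomputable section

open MeasureTheory MeasureTheory.Measure NumberField NumberField.InfinitePlace Topology
open scoped ENNReal Classical
open Literature.NumberTheory.Automorphic Literature.NumberTheory.Automorphic.UnitaryGroup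
open Summit.HodgeConjecture.HodgeConjecture.R90.S10 (GInf phi3)

namespace Summit.HodgeConjecture.HodgeConjecture.R90.S2

/-! ## §1 Generic: a factor of a right-invariant product measure is right-invariant -/

section Generic

/-- **A FACTOR OF A RIGHT-INVARIANT FINITE PRODUCT MEASURE IS RIGHT-INVARIANT** when every factor is non-degenerate (a measurable `Kᵢ` with `0 < νᵢ Kᵢ < ∞`): test the
right-invariance of `⊗ ν` under `Pi.mulSingle i g` on the boxes `∏ⱼ (update K i A) j` and cancel the finite non-zero constant `∏_{j ≠ i} νⱼ Kⱼ` (`Measure.pi_pi`).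
[cite: Folland1995, §2.2 (2.52)] [cite: BourbakiINT7, Ch. VII §1 no. 2] -/
theorem isMulRightInvariant_of_pi {ι : Type*} [Fintype ι] {G : ι → Type*} [∀ i, Group (G i)] [∀ i, MeasurableSpace (G i)] [∀ i, MeasurableMul (G i)]
    (ν : ∀ i, Measure (G i)) [∀ i, SigmaFinite (ν i)] [(Measure.pi ν).IsMulRightInvariant]
    (hK : ∀ i, ∃ K : Set (G i), MeasurableSet K ∧ ν i K ≠ 0 ∧ ν i K ≠ ⊤) (i : ι) : (ν i).IsMulRightInvariant := by
  classical
  choose K hKm hK0 hKt using hK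
  refine ⟨fun g => Measure.ext fun A hA => ?_⟩
  rw [Measure.map_apply (measurable_mul_const g) hA]
  -- the measure of a box with the slot `i` replaced
  have hbox : ∀ B : Set (G i), Measure.pi ν (Set.univ.pi (Function.update K i B)) = ν i B * ∏ j ∈ Finset.univ.erase i, ν j (K j) := by
    intro B
    rw [Measure.pi_pi, ← Finset.mul_prod_erase Finset.univ _ (Finset.mem_univ i), Function.update_self]
    congr 1
    exact Finset.prod_congr rfl fun j hj => by rw [Function.update_of_ne (Finset.ne_of_mem_erase hj)]
  -- right translation by `mulSingle i g` moves the slot `i` only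
  have hpre : (fun x : (∀ j, G j) => x * Pi.mulSingle i g) ⁻¹' Set.univ.pi (Function.update K i A) =
      Set.univ.pi (Function.update K i ((fun y : G i => y * g) ⁻¹' A)) := by
    ext x
    simp only [Set.mem_preimage, Set.mem_univ_pi, Pi.mul_apply]
    refine forall_congr' fun j => ?_
    by_cases hj : j = i
    · subst hj
      rw [Function.update_self, Function.update_self, Pi.mulSingle_eq_same, Set.mem_preimage]
    · rw [Function.update_of_ne hj, Function.update_of_ne hj, Pi.mulSingle_eq_of_ne hj, mul_one]
  have hmeas : MeasurableSet (Set.univ.pi (Function.update K i A)) := MeasurableSet.univ_pi fun j => by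
    by_cases hj : j = i
    · subst hj; rw [Function.update_self]; exact hA
    · rw [Function.update_of_ne hj]; exact hKm j
  have h := congrArg (fun μ : Measure (∀ j, G j) => μ (Set.univ.pi (Function.update K i A)))
    (map_mul_right_eq_self (Measure.pi ν) (Pi.mulSingle i g))
  rw [Measure.map_apply (measurable_mul_const _) hmeas, hpre, hbox, hbox] at h
  have hC0 : ∏ j ∈ Finset.univ.erase i, ν j (K j) ≠ 0 := Finset.prod_ne_zero_iff.2 fun j _ => hK0 j
  have hCt : ∏ j ∈ Finset.univ.erase i, ν j (K j) ≠ ⊤ := ENNReal.prod_ne_top fun j _ => hKt j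
  exact (ENNReal.mul_left_inj hC0 hCt).1 h

/-- On a locally compact group every Haar measure is non-degenerate in the sense of §1: a compact neighbourhood of `1` is measurable, of positive and finite measure.
[cite: Folland1995, §2.2 (2.20)] -/
theorem exists_measurableSet_ne_zero_ne_top_of_isHaarMeasure {G : Type*} [Group G] [TopologicalSpace G] [IsTopologicalGroup G] [LocallyCompactSpace G]
    [T2Space G] [MeasurableSpace G] [BorelSpace G] (μ : Measure G) [μ.IsHaarMeasure] : ∃ K : Set G, MeasurableSet K ∧ μ K ≠ 0 ∧ μ K ≠ ⊤ := by
  obtain ⟨K, hKc, hK1⟩ := exists_compact_mem_nhds (1 : G)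
  exact ⟨K, hKc.measurableSet, (measure_pos_of_mem_nhds μ hK1).ne', hKc.measure_lt_top.ne⟩

end Generic

/-! ## §2 The arch instance in CARD 8's frame: every local Haar factor `νw w` of a right-invariant `ν` on `G_∞` is right-invariant -/

section Arch

/-- **EVERY LOCAL HAAR FACTOR OF A RIGHT-INVARIANT HAAR MEASURE ON `G_∞ = U(Φ₃)(L⁺ ⊗ ℝ)` IS RIGHT-INVARIANT**: if `ν.map archPiEquivCM = ⊗_w νw w` with `ν` right-invariant,
then each `νw w` is right-invariant (`⊗ νw` is right-invariant by ★ `isMulRightInvariant_map_continuousMulEquiv`, then §1 with compact neighbourhoods of `1` in the locally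
compact factors `U(σ_w Φ₃)(ℂ)`).  Binders spelled as CARD 8's frame, so CARD 12 applies it BY NAME. [cite: Folland1995, §2.2 (2.52)] [cite: Rogawski1990, §14.2 p. 232] -/
theorem isMulRightInvariant_of_map_archPiEquivCM_eq_pi (L : Type) [Field L] [NumberField L] [IsCMField L]
    [MeasurableSpace (GInf L)] [BorelSpace (GInf L)] (ν : Measure (GInf L)) [ν.IsHaarMeasure] [ν.IsMulRightInvariant]
    [∀ w : {w : InfinitePlace L // w.IsComplex}, MeasurableSpace ↥(archLocal L 3 (phi3 L) w)]
    [∀ w : {w : InfinitePlace L // w.IsComplex}, BorelSpace ↥(archLocal L 3 (phi3 L) w)]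
    (νw : ∀ w : {w : InfinitePlace L // w.IsComplex}, Measure ↥(archLocal L 3 (phi3 L) w)) [∀ w, (νw w).IsHaarMeasure]
    (hν : ν.map ⇑(archPiEquivCM L (phi3 L) (N := 3)) = Measure.pi νw) (w : {w : InfinitePlace L // w.IsComplex}) :
    (νw w).IsMulRightInvariant := by
  haveI : ∀ w' : {w : InfinitePlace L // w.IsComplex}, LocallyCompactSpace ↥(archLocal L 3 (phi3 L) w') :=
    fun w' => locallyCompactSpace_archLocal L 3 (phi3 L) w'
  haveI : ∀ w' : {w : InfinitePlace L // w.IsComplex}, SecondCountableTopology ↥(archLocal L 3 (phi3 L) w') :=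
    fun w' => secondCountableTopology_archLocal L 3 (phi3 L) w'
  have hpi : (ν.map ⇑(archPiEquivCM L (phi3 L) (N := 3))).IsMulRightInvariant :=
    isMulRightInvariant_map_continuousMulEquiv (archPiEquivCM L (phi3 L) (N := 3)) ν
  rw [hν] at hpi
  exact isMulRightInvariant_of_pi νw (fun w' => exists_measurableSet_ne_zero_ne_top_of_isHaarMeasure (νw w')) w

end Arch

end Summit.HodgeConjecture.HodgeConjecture.R90.S2

end
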